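import Summits.CriticalPhenomena.PercolationContinuityZ3.Theorems.Transplant.SkelNeg1ClosureResidues
import Summits.CriticalPhenomena.PercolationContinuityZ3.Theorems.Transplant.SkelConcChoice
import HarnessLib

/-!
# N1 (the {±1} node): CHOICES AS DATA and the single-type target from a CHOICE FUNCTION — `PlanarSkeletonNeg.ChoiceN` (twin of D″'s `PlanarSkeletonSign.Choice`
# over the Step-I″ record `StepI.DataN`, the pairs index `indexNP`, and an ABSTRACT anchored-cells scheme `Γ` with face/level data and the face residue's window
# map `ψ`), the named obligations `GeomHoldsN / RootHoldsN / FaceHoldsRN / ReachHoldsRHN` (and their `…Fn` forms over a choice function `ChoiceFnN`), and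
# **`samePDropOfSkeletonNeg₁_of_choiceFnN`**: a choice function meeting the four obligations gives `SamePDropOfSkeletonNeg₁`

This is the file each residue owner states ONE theorem against (hp-8: `GeomHoldsNFn 𝒞₀` with p1's run records and `FaceHoldsRNFn 𝒞₀`; p1 (route datum/kits): `RootHoldsNFn 𝒞₀`;
p5: `ReachHoldsRHNFn 𝒞₀`; stmt: the choice function `𝒞₀` itself — `δI`, `m₀`, `Sz`, `SMn` with `S_adm` from `NegPrm.SMn_adm`), after which the node₁ file is five lines.
builds on p205010 (kernel theorem, internal audit signed; external expert review pending) — nothing here uses p205010; `SamePDropOfSkeletonNeg₁` stays OPEN (conditional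
assembly).  Lane `prim-bschramm`, seat `prim-bschramm-p3` (gen 8; design owner); helper file (`--supports stmt-CriticalPhenomena-4575`); NEG-SCOPE §5 / B.6.
[cite: KozmaNitzan2024, §4 Theorem 6 (pp. 25–31); §1 p. 2 (approach 1)] [cite: MartineauTassion2017, §3.4]
-/

noncomputable section

open MeasureTheory ProbabilityTheory
open scoped ENNReal Classical

namespace Summit.CriticalPhenomena.PercolationContinuityZ3.Theorems.Transplant

open Literature.Probability.Percolation Literature.Probability.LatticeModels SimpleGraph KNCells
open Literature.Barriers.CriticalPhenomena (HasExponentialGrowth)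

/-! ## §1 The facts Step I″ guarantees about its record -/

namespace Skelφ.StepI

variable {V : Type} {G : SimpleGraph V} [G.LocallyFinite]

/-- **The facts Step I″ guarantees about its record** (frames `hfr`, Φ2 `hC`, least seed level `m₀`, base vertex `t`): seed level bounds, radius and zone family of
record, and the geometric clause at every admissible `(M, n)`. [this work] -/
def DataN.FactsN {φ : V → Site 2} {types : Finset V} [Countable V] (hfr : Frames G φ types) {p : unitInterval} (hC : CylSubcritical G φ types p) (m₀ : ℕ)
    (t : V) (D : DataN V) : Prop :=
  m₀ ≤ D.k ∧ 1 ≤ D.k ∧ D.k ≤ D.M₀ ∧ D.R = fatRadius hfr hC ∧ D.Λ = fatSeq hfr hC ∧ ∀ M, D.M₀ ≤ M → ∀ n, D.n₁ M ≤ n → D.EqGeom G φ t M n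

end Skelφ.StepI

/-! ## §2 Choices as data -/

namespace PlanarSkeletonNeg

open SkelConc (Consts)

variable {V : Type} [DecidableEq V] [Countable V] {G : SimpleGraph V} [G.LocallyFinite]

/-- **The N1 instance's choices at a one-type `(Φ, t, p)`** for the constants `κ`: the Step-I″ accuracy and least seed level, and — as functions of the Step-I″
record (and of the running density where density-dependent) — the zone sizes, the admissible pairs, the anchored-cells scheme, its face and level data, and the
window map the face residue reads. [this work] -/
structure ChoiceN (κ : Consts) (Φ : PlanarSkeletonNeg G) (t : V) (p : unitInterval) (hC : Φ.CylSubcritical p) where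
  /-- Step-I″ accuracy -/
  δI : ℝ
  /-- least seed level asked of Step I″ -/
  m₀ : ℕ
  /-- the finite list of zone sizes -/
  Sz : Skelφ.StepI.DataN V → Finset ℕ
  /-- the finite list of admissible (zone size, width) pairs -/
  SMn : Skelφ.StepI.DataN V → Finset (ℕ × ℕ)
  /-- the anchored cells at the running density -/
  Γ : Skelφ.StepI.DataN V → unitInterval → CellGeom V ℕ
  /-- the face data at the running density -/
  FD : Skelφ.StepI.DataN V → unitInterval → FaceData V ℕ
  /-- the level data at the running density -/
  LD : Skelφ.StepI.DataN V → unitInterval → LevelData V ℕ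
  /-- the window map the face residue reads -/
  ψ : Skelφ.StepI.DataN V → V → Site 2
  δI_pos : 0 < δI
  δI_lt_one : δI < 1
  S_adm : ∀ D : Skelφ.StepI.DataN V, D.FactsN Φ.frame hC m₀ t →
    (∀ M ∈ Sz D, D.M₀ ≤ M) ∧ (∀ q ∈ SMn D, D.M₀ ≤ q.1 ∧ D.n₁ q.1 ≤ q.2)

namespace ChoiceN

variable {κ : Consts} {Φ : PlanarSkeletonNeg G} {t : V} {p : unitInterval} {hC : Φ.CylSubcritical p}

/-- **The premises of step (B) at the running density `q`**: the Step-I″ facts about `D`, `q ∈ [p/2, p]`, the Step-I″ family (type `t`) over the chosen pairs index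
holds at `q` with accuracy `δI`, and Φ2 at `q`. [this work] -/
def AtQ (𝒞 : ChoiceN κ Φ t p hC) (D : Skelφ.StepI.DataN V) (q : unitInterval) : Prop :=
  D.FactsN Φ.frame hC 𝒞.m₀ t ∧ (p : ℝ) / 2 ≤ q ∧ (q : ℝ) ≤ p ∧
    (∀ i ∈ Skelφ.StepI.indexNP {t} (𝒞.Sz D) (𝒞.SMn D), 1 - 𝒞.δI < (bondPercolation G q).real (Skelφ.StepI.eventN G Φ.φ D i)) ∧
    Φ.CylSubcritical q

/-- The chosen anchored-cells scheme at `q` (chain accuracy `κ.δ`). [this work] -/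
abbrev scheme (𝒞 : ChoiceN κ Φ t p hC) (D : Skelφ.StepI.DataN V) (q : unitInterval) : KSchA V ℕ := ⟨𝒞.Γ D q, q, κ.δ⟩

/-- **The geometric obligation**: root, `K₀ ≤ K`, `Lip ψ`, and the six scheme geometries whenever `AtQ`. [this work] -/
def GeomHoldsN (𝒞 : ChoiceN κ Φ t p hC) : Prop :=
  ∀ (D : Skelφ.StepI.DataN V) (q : unitInterval), 𝒞.AtQ D q →
    (𝒞.Γ D q).root = t ∧ κ.K₀ ≤ (𝒞.Γ D q).K ∧ Skelφ.Lip G (𝒞.ψ D) ∧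
      RunGeom G (𝒞.Γ D q) ∧ AnchGeom (𝒞.Γ D q) ∧ SepGeom₂ G (𝒞.Γ D q) ∧ ExitGeom G (𝒞.Γ D q) ∧ StepsGeom (𝒞.Γ D q) (𝒞.FD D q) ∧
      LevelGeom G (𝒞.Γ D q) (𝒞.FD D q) (𝒞.LD D q)

/-- **The root residue at the choices** ((R)/kits at the root; KN §4 (32) at the root). [this work] -/
def RootHoldsN (𝒞 : ChoiceN κ Φ t p hC) : Prop :=
  ∀ (D : Skelφ.StepI.DataN V) (q : unitInterval), 𝒞.AtQ D q → Skel.RootOblT G (𝒞.scheme D q) Φ.Δ κ.δr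

/-- **The face residue at the choices, run-restricted form** ((F)). [this work] -/
def FaceHoldsRN (𝒞 : ChoiceN κ Φ t p hC) : Prop :=
  ∀ (D : Skelφ.StepI.DataN V) (q : unitInterval), 𝒞.AtQ D q → Skelφ.FaceOblR G (𝒞.ψ D) (𝒞.scheme D q) (𝒞.FD D q) Φ.Δ κ.δ₂

/-- **The corridor residue at the choices, run-restricted habitat form with budget `nmaxN`** ((C)). [this work] -/
def ReachHoldsRHN (𝒞 : ChoiceN κ Φ t p hC) : Prop :=
  ∀ (D : Skelφ.StepI.DataN V) (q : unitInterval), 𝒞.AtQ D q → Skel.ReachOblRHN G Skel.nmaxN (𝒞.scheme D q) (𝒞.FD D q) Φ.Δ κ.δ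

end ChoiceN

/-- **An N1 choice function**: choices for every handed constants `κ` and every admissible ONE-TYPE `(G, Φ, t, p, hC)` with `G` NOT of exponential growth
(`t ∈ Φ.types`, `Φ.types = {t}`, `0 < p < 1`, Φ2 at `p`; no base-position normalisation). [this work] -/
def ChoiceFnN : Type 1 :=
  ∀ (κ : Consts) {V : Type} [DecidableEq V] [Countable V] (G : SimpleGraph V) [G.LocallyFinite] (Φ : PlanarSkeletonNeg G),
    ¬ HasExponentialGrowth G → ∀ (t : V), t ∈ Φ.types → Φ.types = {t} → ∀ (p : unitInterval), 0 < (p : ℝ) → (p : ℝ) < 1 →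
      ∀ (hC : Φ.CylSubcritical p), ChoiceN κ Φ t p hC

/-- The geometric obligation of a choice function. [this work] -/
def GeomHoldsNFn (𝒞₀ : ChoiceFnN) : Prop :=
  ∀ (κ : Consts) {V : Type} [DecidableEq V] [Countable V] (G : SimpleGraph V) [G.LocallyFinite] (Φ : PlanarSkeletonNeg G)
    (hg : ¬ HasExponentialGrowth G) (t : V) (ht : t ∈ Φ.types) (h1 : Φ.types = {t}) (p : unitInterval) (hp0 : 0 < (p : ℝ)) (hp1 : (p : ℝ) < 1)
    (hC : Φ.CylSubcritical p), (𝒞₀ κ G Φ hg t ht h1 p hp0 hp1 hC).GeomHoldsN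

/-- **The root obligation of a choice function** ((R)). [this work] -/
def RootHoldsNFn (𝒞₀ : ChoiceFnN) : Prop :=
  ∀ (κ : Consts) {V : Type} [DecidableEq V] [Countable V] (G : SimpleGraph V) [G.LocallyFinite] (Φ : PlanarSkeletonNeg G)
    (hg : ¬ HasExponentialGrowth G) (t : V) (ht : t ∈ Φ.types) (h1 : Φ.types = {t}) (p : unitInterval) (hp0 : 0 < (p : ℝ)) (hp1 : (p : ℝ) < 1)
    (hC : Φ.CylSubcritical p), (𝒞₀ κ G Φ hg t ht h1 p hp0 hp1 hC).RootHoldsN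

/-- **The face obligation of a choice function, run-restricted form** ((F)). [this work] -/
def FaceHoldsRNFn (𝒞₀ : ChoiceFnN) : Prop :=
  ∀ (κ : Consts) {V : Type} [DecidableEq V] [Countable V] (G : SimpleGraph V) [G.LocallyFinite] (Φ : PlanarSkeletonNeg G)
    (hg : ¬ HasExponentialGrowth G) (t : V) (ht : t ∈ Φ.types) (h1 : Φ.types = {t}) (p : unitInterval) (hp0 : 0 < (p : ℝ)) (hp1 : (p : ℝ) < 1)
    (hC : Φ.CylSubcritical p), (𝒞₀ κ G Φ hg t ht h1 p hp0 hp1 hC).FaceHoldsRN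

/-- **The corridor obligation of a choice function, habitat form with budget `nmaxN`** ((C)). [this work] -/
def ReachHoldsRHNFn (𝒞₀ : ChoiceFnN) : Prop :=
  ∀ (κ : Consts) {V : Type} [DecidableEq V] [Countable V] (G : SimpleGraph V) [G.LocallyFinite] (Φ : PlanarSkeletonNeg G)
    (hg : ¬ HasExponentialGrowth G) (t : V) (ht : t ∈ Φ.types) (h1 : Φ.types = {t}) (p : unitInterval) (hp0 : 0 < (p : ℝ)) (hp1 : (p : ℝ) < 1)
    (hC : Φ.CylSubcritical p), (𝒞₀ κ G Φ hg t ht h1 p hp0 hp1 hC).ReachHoldsRHN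

/-! ## §3 The single-type node from a choice function -/

/-- **THE N1 PARTIAL CLOSURE OF RECORD, shared-choice form**: a choice function whose choices meet the geometric, root, face and corridor obligations gives
`SamePDropOfSkeletonNeg₁` (through `samePDropOfSkeletonNeg₁_of_residuesN`; Step I″, Hutchcroft, Burton–Keane, `p_c < 1` and the constants are all inside).
[cite: KozmaNitzan2024, §4 Theorem 6 (pp. 25–31); §1 p. 2] -/
theorem samePDropOfSkeletonNeg₁_of_choiceFnN (𝒞₀ : ChoiceFnN) (hGm : GeomHoldsNFn 𝒞₀) (hR : RootHoldsNFn 𝒞₀) (hF : FaceHoldsRNFn 𝒞₀)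
    (hRe : ReachHoldsRHNFn 𝒞₀) : SamePDropOfSkeletonNeg₁ := by
  refine samePDropOfSkeletonNeg₁_of_residuesN
    fun K₀ δ δ₂ δr hδ0 hδ1 hδ₂0 hδ₂1 hδr {V} _ _ G _ Φ hg t ht h1 p hp0 hp1 _ hC _ => ?_
  set κ : Consts := ⟨K₀, δ, δ₂, δr, hδ0, hδ1, hδ₂0, hδ₂1, hδr⟩ with hκ
  set 𝒞 := 𝒞₀ κ G Φ hg t ht h1 p hp0 hp1 hC with h𝒞
  refine ⟨𝒞.δI, 𝒞.m₀, 𝒞.δI_pos, 𝒞.δI_lt_one, fun D hk₀ hk₁ hkM hR' hΛ hgeom => ?_⟩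
  have hfacts : D.FactsN Φ.frame hC 𝒞.m₀ t := ⟨hk₀, hk₁, hkM, hR', hΛ, hgeom⟩
  obtain ⟨hSz, hSMn⟩ := 𝒞.S_adm D hfacts
  refine ⟨𝒞.Sz D, 𝒞.SMn D, hSz, hSMn, fun q hq1 hq2 hin hCq => ?_⟩
  have hat : 𝒞.AtQ D q := ⟨hfacts, hq1, hq2, hin, hCq⟩
  obtain ⟨hroot, hK, hlipψ, hrun, hanch, hsep, hexit, hsteps, hlev⟩ := hGm κ G Φ hg t ht h1 p hp0 hp1 hC D q hat
  exact ⟨ℕ, 𝒞.Γ D q, 𝒞.FD D q, 𝒞.LD D q, 𝒞.ψ D, hroot, hK, hlipψ, hrun, hanch, hsep, hexit, hsteps, hlev,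
    hR κ G Φ hg t ht h1 p hp0 hp1 hC D q hat, hF κ G Φ hg t ht h1 p hp0 hp1 hC D q hat, hRe κ G Φ hg t ht h1 p hp0 hp1 hC D q hat⟩

end PlanarSkeletonNeg

end Summit.CriticalPhenomena.PercolationContinuityZ3.Theorems.Transplant

end
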